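import Mathlib
import Literature.RepresentationTheory.FiniteGroups.CharacterDegrees
import Literature.RepresentationTheory.FiniteGroups.IrreducibleCharacters
import Literature.RepresentationTheory.FiniteGroups.InducedClassFunction
import Literature.RepresentationTheory.FiniteGroups.BrauerInduction
import Literature.RepresentationTheory.FiniteGroups.EquivOfCharacter
import Literature.RepresentationTheory.FiniteGroups.IsotypicProjector
import Literature.RepresentationTheory.FiniteGroups.RepresentationRing
import Summits.MatrixMultiplication.MatrixMultiplication.Theorems.LieRankDesigns.Negative.Basics
import Summits.MatrixMultiplication.MatrixMultiplication.Theorems.LevelGradedCohnUmansLieRankDesignsStubLevelOfFixedVector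

/-!
# Irreducible constituents of a level-`k` character have level `k`

Supports stmt-MatrixMultiplication-14079 (route `LevelGradedCohnUmans`).  VALUE = theorem, NOT summit
progress.  The structural input missing for the general-`k` budget lemma (BLOCK-SLICES Lemma 2.1):
the Fourier level sets `F_k ⊆ ℂ^{GL_m(𝔽_p)}` of the crux are invariant under right translation
(`translate_mem_levelSet`: `tr(M·g t) = tr((tM)·g)` and `rank (tM) = rank M`), hence

* `irrConstituent_mem_levelSet` — **every irreducible constituent `ψ` (`⟨ψ, Φ⟩ ≠ 0`) of a character
  `Φ ∈ F_k` lies in `F_k`**;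
* `exists_irrChar_levelSet_degree_ge` — consequently some irreducible `ψ ∈ Irr ∩ F_k` has
  `ψ(1) ≥ Φ(1) / ⟨Φ, Φ⟩` (write `Φ = ∑ m_χ χ`; `Φ(1) = ∑ m_χ χ(1) ≤ (∑ m_χ²) max χ(1)`).

So a level-`k` character of large degree and bounded norm (e.g. a permutation character
`Ind_P^G 1` with `P` a parabolic, norm `= |P\G/P|`) produces a large-degree IRREDUCIBLE character of
level `k` — reducing Lemma 2.1 for general `k` to an orbit count, with no unipotent character theory.

The finite-group engine (any finite group `G`, Serre §2.6 Thm. 8):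
* `trace_rep_comp_isotypicProj` — `tr(ρ(g) P_ψ) = ⟨ψ, χ_ρ⟩ ψ(g)` for the isotypic projector
  `P_ψ = (ψ(1)/|G|) ∑_t ψ(t) ρ(t⁻¹)` (`IsotypicProjector.lean`; induction over a Maschke
  decomposition, `rep_induction`);
* `classInner_mul_apply_eq_sum` — hence `⟨ψ, Φ⟩ ψ(g) = ∑_t (ψ(1)/|G|) ψ(t) Φ(g t⁻¹)`: the
  `ψ`-isotypic part of `Φ` is a combination of right translates of `Φ`;
* `constituent_mem` — a right-translation-invariant subspace containing `Φ` contains its constituents.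
-/

set_option linter.dupNamespace false

noncomputable section

open scoped BigOperators Matrix Classical
open Module
open Literature.RepresentationTheory.FiniteGroups
open Summit.MatrixMultiplication.MatrixMultiplication.Theorems.LieRankDesigns.Negative
  (GLm Mat fourierFn RankSupp levelSet re_apply_one_nonneg)
open Summit.MatrixMultiplication.MatrixMultiplication.Theorems.LieRankDesigns.LevelOfFixedVector
  (zero_mem_levelSet add_mem_levelSet smul_mem_levelSet sum_mem_levelSet)

namespace Summit.MatrixMultiplication.MatrixMultiplication.Theorems.SubgroupIdentityDesigns.Negative
namespace ConstituentLevel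

/-! ## The finite-group engine -/

section Engine

variable {G : Type} [Group G] [Fintype G]

omit [Fintype G] in
/-- Transport of `ρ(g)` along an equivalence of representations: `σ(g) = e ρ(g) e⁻¹`. -/
theorem rep_eq_conj {V W : Type} [AddCommGroup V] [Module ℂ V] [AddCommGroup W] [Module ℂ W]
    {ρ : Representation ℂ G V} {σ : Representation ℂ G W} (e : ρ.Equiv σ) (g : G) :
    σ g = e.toLinearEquiv.conj (ρ g) := by
  refine LinearMap.ext fun w => ?_
  rw [LinearEquiv.conj_apply_apply]
  have h := LinearMap.congr_fun (e.isIntertwining' g) (e.toLinearEquiv.symm w)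
  rw [LinearMap.coe_comp, LinearMap.coe_comp, Function.comp_apply, Function.comp_apply,
    ← Representation.Equiv.toLinearEquiv_toLinearMap, LinearEquiv.coe_coe,
    LinearEquiv.apply_symm_apply] at h
  exact h.symm

/-- **`tr(ρ(g) P_ψ) = ⟨ψ, χ_ρ⟩ ψ(g)`** for an irreducible character `ψ` and any finite-dimensional
representation `ρ` (Serre §2.6 Thm. 8: `P_ψ` is the projection onto the `ψ`-isotypic component,
on which `ρ(g)` has trace `m_ψ ψ(g)`). -/
theorem trace_rep_comp_isotypicProj {V : Type} [AddCommGroup V] [Module ℂ V] [FiniteDimensional ℂ V]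
    (ρ : Representation ℂ G V) {ψ : G → ℂ} (hψ : IsIrrChar G ψ) (g : G) :
    LinearMap.trace ℂ V (ρ g ∘ₗ isotypicProj ρ ψ) = classInner ψ ρ.character * ψ g := by
  refine rep_induction (G := G)
    (fun W _ _ σ => LinearMap.trace ℂ W (σ g ∘ₗ isotypicProj σ ψ) = classInner ψ σ.character * ψ g)
    ?_ ?_ ?_ (finrank ℂ V) V ρ le_rfl
  · intro W _ _ _ σ
    have h0 : σ g ∘ₗ isotypicProj σ ψ = 0 := LinearMap.ext fun v => Subsingleton.elim _ _
    have hc : σ.character = 0 := by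
      funext s
      show LinearMap.trace ℂ W (σ s) = 0
      rw [show σ s = 0 from LinearMap.ext fun v => Subsingleton.elim _ _, map_zero]
    rw [h0, map_zero, hc, classInner_comm, classInner_zero_left, zero_mul]
  · intro W _ _ _ σ hσ
    by_cases h : σ.character = ψ
    · rw [isotypicProj_eq_id_of_character_eq σ h, LinearMap.comp_id]
      change σ.character g = _
      rw [h, hψ.classInner_eq hψ, if_pos rfl, one_mul]
    · rw [isotypicProj_eq_zero_of_character_ne σ hψ h, LinearMap.comp_zero, map_zero,
        hψ.classInner_eq (isIrrChar_character σ), if_neg (fun e => h e.symm), zero_mul]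
  · intro W _ _ _ σ p q hpq hp hq
    have hprod : (p.toRepresentation.prod q.toRepresentation) g =
        (p.toRepresentation g).prodMap (q.toRepresentation g) := rfl
    rw [isotypicProj_eq_conj_prodMap σ hpq ψ,
      rep_eq_conj (Subrepresentation.prodEquivOfIsCompl σ p q hpq) g,
      hprod, ← LinearEquiv.conj_comp, LinearMap.prodMap_comp,
      LinearMap.trace_conj', LinearMap.trace_prodMap', hp, hq,
      Representation.character_eq_add_of_isCompl (ρ := σ) p q hpq, classInner_comm ψ (_ + _),
      classInner_add_left, classInner_comm _ ψ, classInner_comm _ ψ]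
    ring

/-- **The `ψ`-isotypic part of a character is a combination of its right translates**:
`⟨ψ, Φ⟩ ψ(g) = ∑_t (ψ(1)/|G|) ψ(t) Φ(g t⁻¹)`. -/
theorem classInner_mul_apply_eq_sum {Φ ψ : G → ℂ} (hΦ : IsCharacter G Φ) (hψ : IsIrrChar G ψ)
    (g : G) : classInner ψ Φ * ψ g = ∑ t : G, (ψ 1 / Fintype.card G * ψ t) * Φ (g * t⁻¹) := by
  obtain ⟨V, _, _, _, ρ, rfl⟩ := hΦ
  rw [← trace_rep_comp_isotypicProj ρ hψ g]
  have hcomp : ρ g ∘ₗ isotypicProj ρ ψ =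
      ∑ t : G, (ψ 1 / Fintype.card G * ψ t) • (ρ (g * t⁻¹) : V →ₗ[ℂ] V) := by
    refine LinearMap.ext fun v => ?_
    simp only [LinearMap.coe_comp, Function.comp_apply, isotypicProj_apply, map_sum, map_smul,
      LinearMap.coe_sum, Finset.sum_apply, LinearMap.smul_apply, map_mul, Module.End.mul_apply]
  rw [hcomp, map_sum]
  refine Finset.sum_congr rfl fun t _ => ?_
  rw [map_smul, smul_eq_mul]
  rfl

/-- **A right-translation-invariant subspace containing a character contains its irreducible
constituents.** -/
theorem constituent_mem {S : Submodule ℂ (G → ℂ)} (hS : ∀ f ∈ S, ∀ t : G, (fun g => f (g * t)) ∈ S)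
    {Φ ψ : G → ℂ} (hΦ : IsCharacter G Φ) (hΦS : Φ ∈ S) (hψ : IsIrrChar G ψ)
    (hm : classInner ψ Φ ≠ 0) : ψ ∈ S := by
  have hkey : (fun g => classInner ψ Φ * ψ g) ∈ S := by
    have h : (fun g => classInner ψ Φ * ψ g) =
        ∑ t : G, (ψ 1 / Fintype.card G * ψ t) • (fun g => Φ (g * t⁻¹)) := by
      funext g
      rw [classInner_mul_apply_eq_sum hΦ hψ g, Finset.sum_apply]
      simp only [Pi.smul_apply, smul_eq_mul]
    rw [h]
    exact Submodule.sum_mem _ fun t _ => Submodule.smul_mem _ _ (hS Φ hΦS t⁻¹)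
  have h2 : ψ = (classInner ψ Φ)⁻¹ • (fun g => classInner ψ Φ * ψ g) := by
    funext g
    simp only [Pi.smul_apply, smul_eq_mul]
    rw [← mul_assoc, inv_mul_cancel₀ hm, one_mul]
  rw [h2]
  exact Submodule.smul_mem _ _ hkey

/-- **A constituent of maximal degree**: if `Φ ≠ 0` is a character in a right-translation-invariant
subspace `S`, some irreducible `ψ ∈ S` has `Φ(1) ≤ ⟨Φ, Φ⟩ ψ(1)` (real parts).  Proof:
`Φ = ∑ m_χ χ` with `m_χ ∈ ℕ`, `Φ(1) = ∑ m_χ χ(1) ≤ (∑ m_χ²) max_{m_χ ≠ 0} χ(1) = ⟨Φ,Φ⟩ max`. -/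
theorem exists_constituent_degree_ge {S : Submodule ℂ (G → ℂ)}
    (hS : ∀ f ∈ S, ∀ t : G, (fun g => f (g * t)) ∈ S) {Φ : G → ℂ} (hΦ : IsCharacter G Φ)
    (hΦS : Φ ∈ S) (hΦ0 : Φ 1 ≠ 0) :
    ∃ ψ : G → ℂ, IsIrrChar G ψ ∧ ψ ∈ S ∧ (Φ 1).re ≤ (classInner Φ Φ).re * (ψ 1).re := by
  set T := (irrChars_finite_holds G).toFinset with hT
  have hTirr : ∀ χ ∈ T, IsIrrChar G χ := fun χ hχ => (irrChars_finite_holds G).mem_toFinset.mp hχ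
  -- multiplicities are natural numbers
  have hnat : ∀ χ ∈ T, ∃ n : ℕ, classInner Φ χ = n :=
    fun χ hχ => hΦ.classInner_irrChar_natCast (hTirr χ hχ)
  have hdec : Φ = ∑ χ ∈ T, classInner Φ χ • χ := hΦ.isClassFun.eq_sum_classInner_smul
  set T' := T.filter (fun χ => classInner Φ χ ≠ 0) with hT'
  have hdec' : Φ = ∑ χ ∈ T', classInner Φ χ • χ := by
    rw [hT', Finset.sum_filter_of_ne]
    · exact hdec
    · intro χ _ hne h0
      exact hne (by rw [h0, zero_smul])
  have hne : T'.Nonempty := by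
    by_contra h
    rw [Finset.not_nonempty_iff_eq_empty] at h
    apply hΦ0
    rw [hdec', h, Finset.sum_empty]
    rfl
  obtain ⟨ψ, hψT', hmax⟩ := T'.exists_max_image (fun χ => (χ 1).re) hne
  have hψT : ψ ∈ T := (Finset.mem_filter.mp hψT').1
  have hψirr : IsIrrChar G ψ := hTirr ψ hψT
  refine ⟨ψ, hψirr, constituent_mem hS hΦ hΦS hψirr ?_, ?_⟩
  · rw [classInner_comm]
    exact (Finset.mem_filter.mp hψT').2
  -- `Φ(1) = ∑ m_χ χ(1)` and `⟨Φ, Φ⟩ = ∑ m_χ²`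
  have hdeg : (Φ 1).re = ∑ χ ∈ T', (classInner Φ χ).re * (χ 1).re := by
    conv_lhs => rw [hdec']
    rw [Finset.sum_apply, Complex.re_sum]
    refine Finset.sum_congr rfl fun χ hχ => ?_
    obtain ⟨n, hn⟩ := hnat χ (Finset.mem_filter.mp hχ).1
    rw [Pi.smul_apply, smul_eq_mul, hn, Complex.mul_re]
    simp
  have hnorm : (classInner Φ Φ).re = ∑ χ ∈ T', (classInner Φ χ).re * (classInner Φ χ).re := by
    conv_lhs => rw [hdec', classInner_sum_left]
    rw [Complex.re_sum]
    refine Finset.sum_congr rfl fun χ hχ => ?_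
    obtain ⟨n, hn⟩ := hnat χ (Finset.mem_filter.mp hχ).1
    rw [classInner_smul_left, classInner_comm χ, ← hdec', hn, Complex.mul_re]
    simp
  rw [hdeg, hnorm, Finset.sum_mul]
  refine Finset.sum_le_sum fun χ hχ => ?_
  obtain ⟨n, hn⟩ := hnat χ (Finset.mem_filter.mp hχ).1
  have hn' : (classInner Φ χ).re = n := by rw [hn]; simp
  rw [hn']
  have h1 : (n : ℝ) ≤ (n : ℝ) * n := by exact_mod_cast Nat.le_mul_self n
  have h2 : (χ 1).re ≤ (ψ 1).re := hmax χ hχ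
  have h3 : 0 ≤ (χ 1).re := re_apply_one_nonneg (hTirr χ (Finset.mem_filter.mp hχ).1)
  nlinarith

end Engine

/-! ## The level sets `F_k` -/

variable {p : ℕ} [hp : Fact p.Prime] {m : ℕ}

/-- **`F_k` is invariant under right translation**: `g ↦ f (g t)` has level `≤ k` if `f` has
(`tr(M·(g t)) = tr((t M)·g)`, `rank (t M) = rank M`). -/
theorem translate_mem_levelSet {k : ℕ} {f : GLm p m → ℂ} (hf : f ∈ levelSet p m k) (t : GLm p m) :
    (fun g => f (g * t)) ∈ levelSet p m k := by
  obtain ⟨c, hc, hcf⟩ := hf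
  have hdet : IsUnit (((t⁻¹ : GLm p m) : Mat p m)).det :=
    (Matrix.isUnit_iff_isUnit_det _).mp (Units.isUnit _)
  refine ⟨fun M => c (((t⁻¹ : GLm p m) : Mat p m) * M), ?_, ?_⟩
  · intro M hM
    exact hc _ (by rwa [Matrix.rank_mul_eq_right_of_isUnit_det _ _ hdet])
  · intro g
    show f (g * t) = _
    rw [hcf]
    unfold fourierFn
    refine Fintype.sum_equiv (Units.mulLeft t) _ _ fun M => ?_
    simp only [Units.mulLeft_apply, Units.inv_mul_cancel_left, Units.val_mul]
    rw [← Matrix.mul_assoc, Matrix.trace_mul_cycle M]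

/-- `F_k` as a `ℂ`-subspace of the functions on `GL_m(𝔽_p)`. -/
def levelSubmodule (p m : ℕ) [Fact p.Prime] (k : ℕ) : Submodule ℂ (GLm p m → ℂ) where
  carrier := levelSet p m k
  zero_mem' := zero_mem_levelSet (p := p) (m := m) k
  add_mem' := fun h₁ h₂ => add_mem_levelSet h₁ h₂
  smul_mem' := fun r _ h => by
    have h' := smul_mem_levelSet h r
    exact h'

/-- Membership in `levelSubmodule` is membership in `levelSet`. -/
theorem mem_levelSubmodule {k : ℕ} {f : GLm p m → ℂ} : f ∈ levelSubmodule p m k ↔ f ∈ levelSet p m k :=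
  Iff.rfl

/-- **Irreducible constituents of a level-`k` character have level `k`.** -/
theorem irrConstituent_mem_levelSet {k : ℕ} {Φ ψ : GLm p m → ℂ} (hΦ : IsCharacter (GLm p m) Φ)
    (hΦk : Φ ∈ levelSet p m k) (hψ : IsIrrChar (GLm p m) ψ) (hm : classInner ψ Φ ≠ 0) :
    ψ ∈ levelSet p m k :=
  (mem_levelSubmodule (p := p)).mp
    (constituent_mem (S := levelSubmodule p m k) (fun _ hf t => translate_mem_levelSet hf t)
      hΦ hΦk hψ hm)

/-- **A large irreducible character of level `k` from any level-`k` character**: if `Φ ∈ F_k` is a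
character with `Φ(1) ≠ 0` then some `ψ ∈ Irr(GL_m(𝔽_p)) ∩ F_k` has `Φ(1) ≤ ⟨Φ, Φ⟩ · ψ(1)`. -/
theorem exists_irrChar_levelSet_degree_ge {k : ℕ} {Φ : GLm p m → ℂ} (hΦ : IsCharacter (GLm p m) Φ)
    (hΦk : Φ ∈ levelSet p m k) (hΦ0 : Φ 1 ≠ 0) :
    ∃ ψ ∈ irrChars (GLm p m) ∩ levelSet p m k, (Φ 1).re ≤ (classInner Φ Φ).re * (ψ 1).re := by
  obtain ⟨ψ, hψ, hψS, hle⟩ := exists_constituent_degree_ge (S := levelSubmodule p m k)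
    (fun _ hf t => translate_mem_levelSet hf t) hΦ hΦk hΦ0
  exact ⟨ψ, ⟨hψ, hψS⟩, hle⟩

end ConstituentLevel
end Summit.MatrixMultiplication.MatrixMultiplication.Theorems.SubgroupIdentityDesigns.Negative
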